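import Literature.AlgebraicGeometry.AbelianSchemes.PoincareSheafBiadditive
import Literature.AlgebraicGeometry.AbelianSchemes.RigidifiedLineBundleComapHom
import Literature.AlgebraicGeometry.AbelianSchemes.AbelianSchemeQuotientMulNDescent
import Literature.AlgebraicGeometry.AbelianVarieties.HomogeneousLineBundleMulPullback
import HarnessLib

/-!
# `([n]_A × 1)^*𝒫 ≅ 𝒫^{⊗n} ≅ (1 × [n]_Â)^*𝒫`: the dual of `[n]_A` is `[n]_Â` (SYM-n)

Layer `Literature/AlgebraicGeometry/AbelianSchemes`, namespace `Literature.AlgebraicGeometry.AbelianSchemes.AbelianSchemeOver`.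
Cell `hodgecm-mathlib`, HECKE-LINK brick H2 file (ii), input of D6 (u2) («`ψ_T^* π_T^* (1 × g₁)^*𝒫 ≅ [n]^*𝒦_{g₁} ≅ 𝒦_{g₁}^{⊗n}
≅ 𝒦_{[n]g₁}`», census `B-provers/B-p20/g9/CENSUS-H2-DualPairOfQuotient.B-p20g9.md` §1 D6).  THEOREMS ONLY.

For an abelian scheme `A/S` over a REDUCED locally Noetherian base with a dual pair `D = (Â, 𝒫)` satisfying the unit hypothesis
`hD : 𝒫|_{A × {ε_Â}} ≅ 𝒪` (★ `AbelianSchemeDualTransport`; ★ `PoincareSheafBiadditive` explains why it is needed):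

* §1 plumbing: `baseChangeHom_mul`/`baseChangeHom_pow_id` (base change of `S`-group-scheme endomorphisms is multiplicative:
  `([n]_A)_T = [n]_{A_T}`), `fibreSlice_eq_restrictLeft`, `restrictLeft_comp_baseChangeHom_left` (restriction to a base point
  commutes with `v_T`), `isHomogeneous_pullback_restrictLeft` (the fibre `𝒫_t` of `𝒫` at a geometric point `t` of `Â` lies in
  `Pic⁰(A_s)` — clause (a) of the dual pair, read on `A ×_S Spec Ω`);
* §2 `exists_tensorPow_family` — `𝒫^{⊗n}` is a rigidified fibrewise-`Pic⁰` family on `A_{Â}` (★ `RigidifiedLineBundleTensor`);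
* §3 **`nonempty_pullback_mulN_iso_tensorPow`** — `([n]_A × 1_Â)^*𝒫 ≅ 𝒫^{⊗n}` on `A ×_S Â`: both sides are rigidified
  fibrewise-`Pic⁰` families on `A` parametrised by the REDUCED scheme `Â`, with isomorphic geometric fibres by the field theorem
  `[n]^*L ≅ L^{⊗n}` on `Pic⁰(A_s)` (★ `nonempty_pullback_pow_id_iso_tensorPow`, [MumfordAV1970] §8 (iv)), so ★
  `nonempty_iso_of_forall_fibre_iso` ([MumfordAV1970] §5 Cor. 6 / §13) applies — no hypothesis `hD` here;
* §4 **`nonempty_pullbackP_pow_iso_tensorPow`** — `(1_A × gⁿ)^*𝒫 ≅ ((1_A × g)^*𝒫)^{⊗n}` for every `T`-valued point `g` of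
  `Â` (★ (P-⊗) `nonempty_pullbackP_mul_iso` iterated; needs `hD`);
* §5 **`nonempty_pullback_mulN_baseChange_pullbackP_iso`** — THE CONSUMER FORM for D6 (u2), any `T`:
  `([n]_{A_T})^*((1_A × g)^*𝒫) ≅ (1_A × gⁿ)^*𝒫` on `A_T` («the dual of `[n]_A` is `[n]_Â`», [MumfordAV1970] §15 / [MilneAV2008]
  I §9), obtained from §3 pulled back along `1_A × g` and §4.

HC_CM is proved only modulo the 7 printed citations until rung 0 closes; nothing here is about HC.

## References
* [MumfordAV1970] D. Mumford, *Abelian Varieties* (1970), §8 (iv) (p. 75), §13 (p. 125), §15 Thm. 1 (p. 143).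
* [MilneAV2008] J. S. Milne, *Abelian Varieties* (v2.00, 2008), I §8 pp. 36–37, I §9.
* [MumfordFogartyKirwan1994] D. Mumford, J. Fogarty, F. Kirwan, *Geometric Invariant Theory*, 3rd ed. (1994), Ch. 6 §1
  Cor. 6.5 (p. 117) (abelian schemes over a reduced base are commutative).
-/

noncomputable section

universe u

open CategoryTheory CategoryTheory.Limits AlgebraicGeometry MonoidalCategory CartesianMonoidalCategory
open scoped MonObj

-- `Scheme.Modules` / `SheafOfModules` are not reducible (as in Mathlib's `AlgebraicGeometry/Modules/Sheaf.lean`).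
set_option backward.isDefEq.respectTransparency false

namespace Literature.AlgebraicGeometry.AbelianSchemes

namespace AbelianSchemeOver

open Literature.AlgebraicGeometry.Motives Literature.AlgebraicGeometry.AbelianVarieties
  Literature.AlgebraicGeometry.Modules

variable {S : Scheme.{u}} (A B : AbelianSchemeOver S)

/-! ## §1 Plumbing: base change of endomorphisms, fibre slices, restriction -/

/-- Base change of `S`-morphisms into a group scheme is multiplicative: `(v₁·v₂)_T = (v₁)_T·(v₂)_T` (Mathlib `Functor.map_mul` for
the cartesian monoidal `Over.pullback f`). [cite: GortzWedhorn2020, Section (4.7), (4.7.1) (p. 108)] -/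
theorem baseChangeHom_mul {T : Scheme.{u}} (f : T ⟶ S) (v₁ v₂ : A.X ⟶ B.X) :
    baseChangeHom (v₁ * v₂) f = baseChangeHom v₁ f * baseChangeHom v₂ f :=
  Functor.map_mul (Over.pullback f) v₁ v₂

/-- Base change preserves the unit morphism: `(1)_T = 1`. [cite: GortzWedhorn2020, Section (4.7), (4.7.1) (p. 108)] -/
theorem baseChangeHom_one {T : Scheme.{u}} (f : T ⟶ S) :
    baseChangeHom (1 : A.X ⟶ B.X) f = (1 : (A.baseChange f).X ⟶ (B.baseChange f).X) :=
  Functor.map_one (Over.pullback f)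

/-- **`([n]_A)_T = [n]_{A_T}`**: base change commutes with multiplication by `n` (`[n] = 𝟙ⁿ`, ★ `mulN`).
[cite: GortzWedhorn2020, Section (4.7), (4.7.1) (p. 108)] -/
theorem baseChangeHom_mulN {T : Scheme.{u}} (f : T ⟶ S) :
    ∀ n : ℕ, baseChangeHom (A.mulN n) f = (A.baseChange f).mulN n
  | 0 => by rw [mulN_def, mulN_def, pow_zero, pow_zero]; exact A.baseChangeHom_one A f
  | n + 1 => by
    rw [mulN_def, mulN_def, pow_succ, pow_succ, baseChangeHom_mul, ← mulN_def, ← mulN_def, baseChangeHom_mulN f n]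
    congr 1
    exact (Over.pullback f).map_id _

/-- The fibre slice of ★ `AbelianSchemeDualPair` at a field-valued point `b` of `B` IS the restriction `1_A × b` of ★
`RigidifiedLineBundleComap` (both are `(pr_A, pr ≫ b) : A ×_S Spec Ω → A ×_S B`). [cite: MilneAV2008, I §8 pp. 36–37] -/
theorem fibreSlice_eq_restrictLeft {Ω : Type u} [Field Ω] (b : Spec (.of Ω) ⟶ B.X.left) :
    A.fibreSlice B b = A.restrictLeft B.X.hom b := by
  apply pullback.hom_ext
  · exact (A.fibreSlice_fst B b).trans (A.restrictLeft_fst B.X.hom b).symm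
  · exact (A.fibreSlice_snd B b).trans (A.restrictLeft_snd B.X.hom b).symm

/-- **Restriction to a base point commutes with the base change of a homomorphism**:
`(1_A × u) ≫ v_T = v_{T′} ≫ (1_B × u)` as morphisms `A_{u ≫ f} → B_T`. [cite: GortzWedhorn2020, Section (4.7) (pp. 107–108)] -/
theorem restrictLeft_comp_baseChangeHom_left {T T' : Scheme.{u}} (f : T ⟶ S) (u : T' ⟶ T) (v : A.X ⟶ B.X) :
    A.restrictLeft f u ≫ (baseChangeHom v f).left = (baseChangeHom v (u ≫ f)).left ≫ B.restrictLeft f u := by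
  have h1 : (baseChangeHom v f).left ≫ pullback.snd B.X.hom f = pullback.snd A.X.hom f := Over.w _
  have h2 : (baseChangeHom v (u ≫ f)).left ≫ pullback.snd B.X.hom (u ≫ f) = pullback.snd A.X.hom (u ≫ f) := Over.w _
  apply pullback.hom_ext
  · calc (A.restrictLeft f u ≫ (baseChangeHom v f).left) ≫ pullback.fst B.X.hom f
          = A.restrictLeft f u ≫ ((baseChangeHom v f).left ≫ pullback.fst B.X.hom f) := Category.assoc _ _ _
      _ = A.restrictLeft f u ≫ (pullback.fst A.X.hom f ≫ v.left) := by rw [baseChangeHom_left_comp_fst]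
      _ = (A.restrictLeft f u ≫ pullback.fst A.X.hom f) ≫ v.left := (Category.assoc _ _ _).symm
      _ = pullback.fst A.X.hom (u ≫ f) ≫ v.left := congrArg (· ≫ v.left) (A.restrictLeft_fst f u)
      _ = (baseChangeHom v (u ≫ f)).left ≫ pullback.fst B.X.hom (u ≫ f) := (baseChangeHom_left_comp_fst v (u ≫ f)).symm
      _ = (baseChangeHom v (u ≫ f)).left ≫ (B.restrictLeft f u ≫ pullback.fst B.X.hom f) :=
          congrArg ((baseChangeHom v (u ≫ f)).left ≫ ·) (B.restrictLeft_fst f u).symm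
      _ = ((baseChangeHom v (u ≫ f)).left ≫ B.restrictLeft f u) ≫ pullback.fst B.X.hom f := (Category.assoc _ _ _).symm
  · calc (A.restrictLeft f u ≫ (baseChangeHom v f).left) ≫ pullback.snd B.X.hom f
          = A.restrictLeft f u ≫ ((baseChangeHom v f).left ≫ pullback.snd B.X.hom f) := Category.assoc _ _ _
      _ = A.restrictLeft f u ≫ pullback.snd A.X.hom f := by rw [h1]
      _ = pullback.snd A.X.hom (u ≫ f) ≫ u := A.restrictLeft_snd f u
      _ = ((baseChangeHom v (u ≫ f)).left ≫ pullback.snd B.X.hom (u ≫ f)) ≫ u := by rw [h2]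
      _ = (baseChangeHom v (u ≫ f)).left ≫ (pullback.snd B.X.hom (u ≫ f) ≫ u) := Category.assoc _ _ _
      _ = (baseChangeHom v (u ≫ f)).left ≫ (B.restrictLeft f u ≫ pullback.snd B.X.hom f) :=
          congrArg ((baseChangeHom v (u ≫ f)).left ≫ ·) (B.restrictLeft_snd f u).symm
      _ = ((baseChangeHom v (u ≫ f)).left ≫ B.restrictLeft f u) ≫ pullback.snd B.X.hom f := (Category.assoc _ _ _).symm

variable {A B}

namespace DualPair

variable (D : A.DualPair)

/-- **The fibre `𝒫_t = (1_A × t)^*𝒫` at a geometric point `t` of `Â` lies in `Pic⁰(A_s)`** (clause (a) of the dual pair, read on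
the abelian variety `A_s = A ×_S Spec Ω`, `s = t ≫ π̂`, through `fibreSlice_eq_restrictLeft`). [cite: MumfordAV1970, §8 ((iv) ⇔ (i))] -/
theorem isHomogeneous_pullback_restrictLeft {Ω : Type u} [Field Ω] [IsAlgClosed Ω] (t : Spec (.of Ω) ⟶ D.hat.X.left) :
    IsHomogeneous (A.fibre (t ≫ D.hat.X.hom)).toAbelianVariety
      ((Scheme.Modules.pullback (A.restrictLeft D.hat.X.hom t)).obj D.P) := by
  rw [← A.fibreSlice_eq_restrictLeft D.hat t]
  exact D.fibrewisePicZero Ω t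

/-! ## §2 `𝒫^{⊗n}` as a rigidified fibrewise-`Pic⁰` family on `A_{Â}` -/

/-- **`𝒫^{⊗n}` is a rigidified fibrewise-`Pic⁰` family on `A ×_S Â`** (parametrised by `Â`): `𝒪`, `𝒫`, and ★
`fibrewisePicZero_tensorObj` by induction. [cite: MilneAV2008, I §8 pp. 36–37] -/
theorem exists_tensorPow_family :
    ∀ n : ℕ, ∃ ℒ : A.RigidifiedLineBundle D.hat.X.hom, ℒ.L = tensorPow D.P n ∧ ℒ.FibrewisePicZero
  | 0 => ⟨⟨SheafOfModules.unit _, hasRank_unit_one, ⟨RigidifiedLineBundle.pullbackUnitIso _⟩⟩, rfl, fun Ω _ _ t =>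
      (isHomogeneous_iff_of_iso _ (RigidifiedLineBundle.pullbackUnitIso _)).2 (isHomogeneous_unit _)⟩
  | n + 1 => by
    obtain ⟨ℒ, hℒ, h₀⟩ := exists_tensorPow_family n
    refine ⟨⟨tensorObj ℒ.L (selfBundle D).L, RigidifiedLineBundle.hasRank_one_tensorObj ℒ (selfBundle D),
      RigidifiedLineBundle.rigid_tensorObj ℒ (selfBundle D)⟩, by change tensorObj ℒ.L D.P = _; rw [hℒ, tensorPow_succ],
      RigidifiedLineBundle.fibrewisePicZero_tensorObj ℒ (selfBundle D) h₀ (selfBundle_fibrewisePicZero D)⟩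

/-! ## §3 `([n]_A × 1_Â)^*𝒫 ≅ 𝒫^{⊗n}` over a reduced base -/

variable [IsReduced S] [IsLocallyNoetherian S]

/-- **`([n]_A × 1_Â)^*𝒫 ≅ 𝒫^{⊗n}` on `A ×_S Â`** for `S` reduced and locally Noetherian ([MumfordAV1970] §8 (iv) in families):
the two sides are the rigidified fibrewise-`Pic⁰` families `comapHom [n]_A 𝒫` (★ `RigidifiedLineBundleComapHom`; `[n]_A` is a
homomorphism because `A` is commutative over a reduced base, ★ `isCommMonObj_of_isReduced_base`) and `𝒫^{⊗n}` (§2) on `A`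
parametrised by the REDUCED scheme `Â` (★ `isReduced_left`); their geometric fibres at `t` are `[n]_{A_s}^*𝒫_t` and `𝒫_t^{⊗n}`,
isomorphic by the field theorem ★ `nonempty_pullback_pow_id_iso_tensorPow` (`𝒫_t ∈ Pic⁰(A_s)`, §1); conclude by ★
`nonempty_iso_of_forall_fibre_iso`. [cite: MumfordAV1970, §8 ((iv), p. 75) and §13 (p. 125)] [cite: MilneAV2008, I §8 pp. 36–37] -/
theorem nonempty_pullback_mulN_iso_tensorPow (n : ℕ) :
    Nonempty ((Scheme.Modules.pullback (baseChangeHom (A.mulN n) D.hat.X.hom).left).obj D.P ≅ tensorPow D.P n) := by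
  haveI : IsCommMonObj A.X := A.isCommMonObj_of_isReduced_base
  haveI : IsMonHom (A.mulN n) := A.isMonHom_mulN n
  haveI : IsReduced D.hat.X.left := D.hat.isReduced_left
  obtain ⟨ℒ₂, hℒ₂, h₂⟩ := D.exists_tensorPow_family n
  rw [← hℒ₂]
  refine nonempty_iso_of_forall_fibre_iso D ((selfBundle D).comapHom (A.mulN n)) ℒ₂
    ((selfBundle_fibrewisePicZero D).comapHom (A.mulN n)) h₂ fun Ω _ _ t => ?_
  rw [RigidifiedLineBundle.comapHom_L, hℒ₂, selfBundle_L]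
  -- the fibre at `t`: `[n]_{A_s}^*𝒫_t ≅ 𝒫_t^{⊗n}` on `A_s = A ×_S Spec Ω`
  have hsq := A.restrictLeft_comp_baseChangeHom_left A D.hat.X.hom t (A.mulN n)
  have hr : HasRank ((Scheme.Modules.pullback (A.restrictLeft D.hat.X.hom t)).obj D.P) 1 := hasRank_pullback _ D.hasRank_one
  obtain ⟨e⟩ := nonempty_pullback_pow_id_iso_tensorPow (A.fibre (t ≫ D.hat.X.hom)).toAbelianVariety hr
    (HasRank.isFiniteLocallyFree' hr) (D.isHomogeneous_pullback_restrictLeft t) n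
  obtain ⟨e'⟩ := nonempty_pullback_tensorPow_iso (A.restrictLeft D.hat.X.hom t) D.hasRank_one n
  have hn : ((𝟙 (A.fibre (t ≫ D.hat.X.hom)).toAbelianVariety.X) ^ n).left = (baseChangeHom (A.mulN n) (t ≫ D.hat.X.hom)).left := by
    rw [A.baseChangeHom_mulN (t ≫ D.hat.X.hom) n, mulN_def]; rfl
  refine ⟨(Scheme.Modules.pullbackComp _ _).app D.P ≪≫ (Scheme.Modules.pullbackCongr hsq).app D.P ≪≫
    ((Scheme.Modules.pullbackComp _ _).app D.P).symm ≪≫ (Scheme.Modules.pullbackCongr hn.symm).app _ ≪≫ e ≪≫ e'.symm⟩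

/-! ## §4 `(1_A × gⁿ)^*𝒫 ≅ ((1_A × g)^*𝒫)^{⊗n}` -/

/-- **`(1_A × gⁿ)^*𝒫 ≅ ((1_A × g)^*𝒫)^{⊗n}`** for every `T`-valued point `g` of `Â` over `S` (★ (P-⊗) `nonempty_pullbackP_mul_iso`
iterated; unit hypothesis `hD`). [cite: MumfordAV1970, §8 (pp. 74–75) and §13 (p. 125)] -/
theorem nonempty_pullbackP_pow_iso_tensorPow
    (hD : Nonempty ((Scheme.Modules.pullback (unitHatSlice D)).obj D.P ≅ SheafOfModules.unit _))
    {T : Scheme.{u}} (f : T ⟶ S) (g : Over.mk f ⟶ D.hat.X) :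
    ∀ n : ℕ, Nonempty (D.pullbackP f (g ^ n).left (Over.w _) ≅ tensorPow (D.pullbackP f g.left (Over.w g)) n)
  | 0 => by
    rw [tensorPow_zero]
    have h1 : ((1 : Over.mk f ⟶ D.hat.X)).left = f ≫ D.hat.unitSection := by
      change (toUnit (Over.mk f) ≫ η[D.hat.X]).left = f ≫ D.hat.unitSection
      rw [Over.comp_left, Over.toUnit_left]; rfl
    have hf : (f ≫ D.hat.unitSection) ≫ D.hat.X.hom = f := by
      rw [Category.assoc, D.hat.unitSection_comp_hom, Category.comp_id]
    have hc : D.pullbackP f ((g ^ 0)).left (Over.w _) = D.pullbackP f (f ≫ D.hat.unitSection) hf :=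
      D.pullbackP_congr f (by rw [pow_zero, h1]) _ _
    rw [hc]
    exact D.nonempty_pullbackP_comp_unitSection_iso f hD hf
  | n + 1 => by
    obtain ⟨e⟩ := nonempty_pullbackP_pow_iso_tensorPow hD f g n
    obtain ⟨m⟩ := D.nonempty_pullbackP_mul_iso hD f (g ^ n) g
    have hc : D.pullbackP f ((g ^ (n + 1))).left (Over.w _) = D.pullbackP f ((g ^ n * g)).left (Over.w _) :=
      D.pullbackP_congr f (by rw [pow_succ]) _ _
    rw [hc, tensorPow_succ]
    exact ⟨m ≪≫ tensorMapIso e (Iso.refl _)⟩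

/-! ## §5 The consumer form: `[n]_{A_T}^* (1_A × g)^*𝒫 ≅ (1_A × gⁿ)^*𝒫` -/

/-- **THE DUAL OF `[n]_A` IS `[n]_Â`** (consumer form for D6 (u2), any `T`): for `S` reduced and locally Noetherian, the unit
hypothesis `hD`, `f : T → S` and a `T`-valued point `g : T → Â` over `S`,
`([n]_{A_T})^* ((1_A × g)^*𝒫) ≅ (1_A × gⁿ)^*𝒫` on `A_T` — §3 pulled back along `1_A × g : A_T → A ×_S Â` (★
`restrictLeft_comp_baseChangeToProd`-type square `(1_A × g) ≫ ([n]_A × 1_Â) = [n]_{A_T} ≫ (1_A × g)`) composed with §4.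
[cite: MumfordAV1970, §15 Thm. 1 (p. 143)] [cite: MilneAV2008, I §9] -/
theorem nonempty_pullback_mulN_baseChange_pullbackP_iso
    (hD : Nonempty ((Scheme.Modules.pullback (unitHatSlice D)).obj D.P ≅ SheafOfModules.unit _))
    {T : Scheme.{u}} (f : T ⟶ S) (g : Over.mk f ⟶ D.hat.X) (n : ℕ) :
    Nonempty ((Scheme.Modules.pullback ((A.baseChange f).mulN n).left).obj (D.pullbackP f g.left (Over.w g)) ≅
      D.pullbackP f (g ^ n).left (Over.w _)) := by
  haveI : IsCommMonObj A.X := A.isCommMonObj_of_isReduced_base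
  obtain ⟨e₁⟩ := D.nonempty_pullback_mulN_iso_tensorPow n
  obtain ⟨e₂⟩ := D.nonempty_pullbackP_pow_iso_tensorPow hD f g n
  obtain ⟨e₃⟩ := nonempty_pullback_tensorPow_iso (A.baseChangeToProd D.hat f g.left (Over.w g)) D.hasRank_one n
  -- the square `(1_A × g) ≫ ([n]_A × 1_Â) = [n]_{A_T} ≫ (1_A × g)` : `A_T → A ×_S Â`
  have hsq : A.baseChangeToProd D.hat f g.left (Over.w g) ≫ (baseChangeHom (A.mulN n) D.hat.X.hom).left =
      ((A.baseChange f).mulN n).left ≫ A.baseChangeToProd D.hat f g.left (Over.w g) := by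
    rw [← A.baseChangeHom_mulN f n]
    have hw : (baseChangeHom (A.mulN n) f).left ≫ pullback.snd A.X.hom f = pullback.snd A.X.hom f := Over.w _
    have hw' : (baseChangeHom (A.mulN n) D.hat.X.hom).left ≫ pullback.snd A.X.hom D.hat.X.hom =
        pullback.snd A.X.hom D.hat.X.hom := Over.w _
    apply pullback.hom_ext
    · calc (A.baseChangeToProd D.hat f g.left (Over.w g) ≫ (baseChangeHom (A.mulN n) D.hat.X.hom).left) ≫
            pullback.fst A.X.hom D.hat.X.hom
            = A.baseChangeToProd D.hat f g.left (Over.w g) ≫ (pullback.fst A.X.hom D.hat.X.hom ≫ (A.mulN n).left) := by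
              rw [Category.assoc, baseChangeHom_left_comp_fst]
        _ = pullback.fst A.X.hom f ≫ (A.mulN n).left := by rw [← Category.assoc, baseChangeToProd_fst]
        _ = ((baseChangeHom (A.mulN n) f).left ≫ pullback.fst A.X.hom f) := (baseChangeHom_left_comp_fst _ _).symm
        _ = ((baseChangeHom (A.mulN n) f).left ≫ A.baseChangeToProd D.hat f g.left (Over.w g)) ≫
            pullback.fst A.X.hom D.hat.X.hom := by rw [Category.assoc, baseChangeToProd_fst]
    · calc (A.baseChangeToProd D.hat f g.left (Over.w g) ≫ (baseChangeHom (A.mulN n) D.hat.X.hom).left) ≫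
            pullback.snd A.X.hom D.hat.X.hom
            = A.baseChangeToProd D.hat f g.left (Over.w g) ≫ pullback.snd A.X.hom D.hat.X.hom := by
              rw [Category.assoc, hw']
        _ = pullback.snd A.X.hom f ≫ g.left := A.baseChangeToProd_snd D.hat f g.left (Over.w g)
        _ = ((baseChangeHom (A.mulN n) f).left ≫ pullback.snd A.X.hom f) ≫ g.left := by rw [hw]
        _ = ((baseChangeHom (A.mulN n) f).left ≫ A.baseChangeToProd D.hat f g.left (Over.w g)) ≫
            pullback.snd A.X.hom D.hat.X.hom := by rw [Category.assoc, Category.assoc, baseChangeToProd_snd]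
  refine ⟨(Scheme.Modules.pullbackComp _ _).app D.P ≪≫ (Scheme.Modules.pullbackCongr hsq.symm).app D.P ≪≫
    ((Scheme.Modules.pullbackComp _ _).app D.P).symm ≪≫ (Scheme.Modules.pullback _).mapIso e₁ ≪≫ e₃ ≪≫ e₂.symm⟩

end DualPair

end AbelianSchemeOver

end Literature.AlgebraicGeometry.AbelianSchemes

end
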